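import Summits.NavierStokesRegularity.FluidComputer.PalasekTowerLundgrenChildCoreClock
import Summits.NavierStokesRegularity.FluidComputer.PalasekTowerLundgrenChildEntropyClockNonneg
import Summits.NavierStokesRegularity.FluidComputer.PalasekTowerRegisterGlobalAt

/-!
# REGISTER v2.3″ (continued): THE CORE FACE OF THE ENTROPY CLOCK FOR THE CO-SIGNED CLASS, AND THE CORE
# CLOCK AS A LOGARITHM — `∮ ≥ Γ(1 − e^{−λA_k r²/4}) − (2ΓH₀)^{1/2} e^{−λA_k s/2}` for a Lundgren-carried child
# whose cross-section is merely NON-NEGATIVE at the hand-over; the clause after `λA_k s ≥ log(3200·H₀/Γ)`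

Cell `ns-blowup`, seat `ns-blowup-ecbridge-8` (g10); evidence toward crux stmt-NavierStokesRegularity-20305
`HeredityFromTwoT` (= `HeredityFromGAt TowerRates.tuned 2`; standing record 19250 `HeredityFromTwo`), floor
`CoreFloorAt k`, MODEL lane «child core = cross-section of Lundgren's stretched flow in the host strain
`c = λA_k` at `ν = 1`». Sequel of `PalasekTowerLundgrenChildCoreClock` (g9, the CORE face for the POSITIVE
LOG-TAME class) answering the refuter's two riders on it (STATUS K197):

* **R2 — the class.** The positivity / log-tameness / log-Lipschitz hypotheses (`hpos`, `hlog`, `hsc` at all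
  planar times) are REMOVED: §1 restates `…_child_rimCirculation_ge` and `…_child_coreClause` for the CO-SIGNED
  class — a classical unforced planar run `ṽ = K₂ ∗ ω̃` on a convex planar-time set `S' ∋ 0` with uniformly
  rapidly decaying vorticity, `ω̃(0) ≥ 0` pointwise and `Γ = ∫ ω̃(0) > 0`, NOTHING ELSE — by swapping g9's 3D
  `L¹` clock for `palasekTowerBreakdown_cosigned_childVorticity_L1_burgers_clock`
  (`PalasekTowerLundgrenChildEntropyClockNonneg`, resting on Gallay–Wayne's Lemma 3.2 for `w₀ ∈ L²(m) ∩ Σ₊`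
  as formalised in `Literature.Analysis.FluidPDE.PlanarVorticityEntropyNonneg`). The proofs are those of g9
  verbatim up to that swap.
* **R1 — the normalisation `H₀ ≤ Γ`.** g9's numeric corollary `…_coreClause_wide` assumed the hand-over
  entropy below the circulation, which is level-dependent and fails at the tuned rates (Gaussian hand-over of
  width `Y_k/N_{k+1}` into the strain `A_k`: `H₀/Γ = KL ≈ 131` at tuned `k = 0`). §2 replaces it by the
  register-generic **LOG CLOCK** `palasekTowerBreakdown_cosigned_child_coreClause_logClock`: for ANY rates `R`,
  any `λ > 0` with core ratio `x_k = λN_k^{β−2b} ≥ 1.95`, any schedule and level, **`3200·H₀ ≤ Γ·e^{λA_k s}`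
  and `Γ ≥ 0.86·c₁N_{k+1}^{β−2}` ⇒ the level-`(k+1)` core clause at strain time `s`** on every cross-section
  `{x₂ = z₀}`, `|z₀| ≤ radius` (`1 − e^{−x/4} ≥ 1 − (1 + x/4)⁻¹ ≥ 0.3277`; `(2ΓH₀)^{1/2}e^{−λA_k s/2} ≤ Γ/40`;
  `4·0.86·(0.3277 − 1/40) > 1`); §3 the tuned instance: `N_k^{β−2b} = 2^{8.1·(33/32)^k} ≥ 256` at EVERY level
  (`TowerRates.tuned_coreRatio_ge`), so `x_k ≥ 1.95` for every `λ ≥ 1/100`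
  (`palasekTowerBreakdown_cosigned_child_coreClause_logClock_tuned`).

REGISTER READING (arithmetic on the displayed constants, not a theorem of this file). The clock is logarithmic in
the hand-over entropy: `λA_k s ≥ log 3200 + log(H₀/Γ) ≈ 8.07 + log(H₀/Γ)` strain times. At the refuter's tuned
Gaussian hand-over (`H₀/Γ ≈ 131`) this is `≈ 12.95` strain times (K197: `12.9–13.8`) of the `4b²β log N₀ ∈
(169.8, 169.9)` strain times of window `0` (`PalasekTowerFaceNumbersTuned.tuned_window_strain_bounds`), i.e.
`< 8 %` of the window at `λ = 1`. WHAT THIS IS NOT: not NS about registered flows; no registered Stage is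
constructed; non-negativity of the hand-over cross-section is a HYPOTHESIS (sign-changing cross-sections are out
of scope — Gallay–Wayne p. 14: «we do not know how to extend the entropy dissipation method to the general case
where the vorticity may change sign»); the vacuity of the register (`HeredityFromGAt … 2` by `not_heredityAtGAt`)
stands and is not used.

## References
* [cite: GallayWayne2005, Lemma 3.2 (p. 11) and §3.4 (p. 14) (arXiv:math/0402449)]
* [cite: Saffman1992, §13.3 eqs. (26)–(29)] · [cite: MajdaBertozziCUP2002, §1.6 (1.60)–(1.61)]
* [cite: Palasek2026ElementaryModel, §3 (3.2), §3.1]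
-/

noncomputable section

namespace Summit.NavierStokesRegularity.FluidComputer.PalasekTowerClayBridge

open Real Set MeasureTheory Function
open scoped RealInnerProductSpace ContDiff
open Literature.Analysis.FluidPDE Literature.Analysis.FluidPDE.Lundgren Literature.Analysis.Calculus
open CoreLedgerStokes CoreClock

variable {S S' : Set ℝ}
  {v : ℝ → EuclideanSpace ℝ (Fin 2) → EuclideanSpace ℝ (Fin 2)}
  {q : ℝ → EuclideanSpace ℝ (Fin 2) → ℝ} {w : ℝ → EuclideanSpace ℝ (Fin 2) → ℝ}

/-! ### §1 The co-signed child core: the rim circulation after the entropy clock -/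

/-- **THE RIM CIRCULATION OF THE CO-SIGNED CHILD IS WITHIN THE `L¹` CLOCK OF THE BURGERS VALUE** (setting
of `palasekTowerBreakdown_cosigned_childVorticity_L1_burgers_clock`: the Lundgren child at constant rate
`c = λA_k`, `ν = 1`, carrying a planar run `ṽ = K₂ ∗ ω̃` with uniformly rapidly decaying vorticity,
NON-NEGATIVE AT THE HAND-OVER (`ω̃(0) ≥ 0`, `Γ = ∫ ω̃(0) > 0`; no positivity / log-tameness / log-Lipschitz
hypothesis), and a smooth passive axial scalar; `H₀` the relative entropy at the hand-over, `0 log 0 = 0`). For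
every strain time `s ≥ 0` of the window `S`,
every height `z₀` and every radius `r > 0`:
**`∮_{circle(z₀e_z, r)} u(s)·dℓ ≥ Γ(1 − e^{−cr²/4}) − (2ΓH₀)^{1/2} e^{−cs/2}`**
— Stokes in set form for the child and for the Burgers vortex, `∮ u_B·dℓ = Γ(1 − e^{−cr²/4})`
(`PalasekTowerChildCoreLedgerStokes`), and
`∫_{disc} |ω_z(s) − ω_B| ≤ ∫_{ℝ²} |ω_z(s) − ω_B| ≤ (2ΓH₀)^{1/2}e^{−cs/2}` (the co-signed 3D `L¹` clock).
[cite: GallayWayne2005, Lemma 3.2 and §3.4; MajdaBertozziCUP2002, §1.6 (1.60)–(1.61); Saffman1992, §13.3 eq. (29)] -/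
theorem palasekTowerBreakdown_cosigned_child_rimCirculation_ge (R : TowerRates) (k : ℕ)
    {l : ℝ} (hl : 0 < l) (hS' : Convex ℝ S') (hv : IsClassicalNSSolutionOn S' 1 0 v q)
    (hω : HasUniformRapidDecayOn S' (fun σ η => PlanarEigenmode.vorticity (v σ) η))
    (hBS : ∀ σ ∈ S', ∀ η, v σ η = biotSavart2D (PlanarEigenmode.vorticity (v σ)) η)
    (h0nn : ∀ η, 0 ≤ PlanarEigenmode.vorticity (v 0) η)
    (hΓ : 0 < ∫ y, PlanarEigenmode.vorticity (v 0) y)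
    (hw : IsSmoothSpaceTimeOn S' w)
    (hmaps : MapsTo (fun t => (exp (l * R.A k * t) - 1) / (l * R.A k)) S S')
    (h0 : (0 : ℝ) ∈ S') {s : ℝ} (hsS : s ∈ S) (hs : 0 ≤ s) (z₀ : ℝ) {r : ℝ} (hr : 0 < r) :
    (∫ y, PlanarEigenmode.vorticity (v 0) y) * (1 - exp (-(l * R.A k * r ^ 2 / 4))) -
        Real.sqrt (2 * (∫ y, PlanarEigenmode.vorticity (v 0) y) *
          ∫ η, PlanarEigenmode.vorticity (v 0) η *
            Real.log (PlanarEigenmode.vorticity (v 0) η /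
              ((∫ y, PlanarEigenmode.vorticity (v 0) y) / (4 * π * (l * R.A k)⁻¹) *
                exp (-(‖η‖ ^ 2 / (4 * (l * R.A k)⁻¹)))))) * exp (-(l * R.A k * s / 2)) ≤
      circulation (velocity (fun _ => l * R.A k)
          (fun t y => exp (l * R.A k * t / 2) •
            v ((exp (l * R.A k * t) - 1) / (l * R.A k)) (exp (l * R.A k * t / 2) • y))
          (fun t y => exp (-(l * R.A k * t)) •
            w ((exp (l * R.A k * t) - 1) / (l * R.A k)) (exp (l * R.A k * t / 2) • y)) s)
        (circleLoop (z₀ • eZ) r (EuclideanSpace.single 0 1) (EuclideanSpace.single 1 1)) := by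
  set c : ℝ := l * R.A k with hc
  have hcpos : 0 < c := mul_pos hl (R.A_pos k)
  set Γ : ℝ := ∫ y, PlanarEigenmode.vorticity (v 0) y with hΓdef
  set U : EuclideanSpace ℝ (Fin 3) → EuclideanSpace ℝ (Fin 3) := velocity (fun _ => c)
    (fun t y => exp (c * t / 2) • v ((exp (c * t) - 1) / c) (exp (c * t / 2) • y))
    (fun t y => exp (-(c * t)) • w ((exp (c * t) - 1) / c) (exp (c * t / 2) • y)) s with hU
  -- smoothness of the Lundgren field's slice
  have hca : ContDiff ℝ ∞ (fun t : ℝ => exp (c * t / 2)) := ((contDiff_const.mul contDiff_id).div_const 2).exp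
  have hcτ : ContDiff ℝ ∞ (fun t : ℝ => (exp (c * t) - 1) / c) :=
    (((contDiff_const.mul contDiff_id).exp).sub contDiff_const).div_const c
  have hcd : ContDiff ℝ ∞ (fun t : ℝ => exp (-(c * t))) := (contDiff_const.mul contDiff_id).neg.exp
  have hV := isSmoothSpaceTimeOn_rescaled (e := fun t => exp (c * t / 2)) hv.smooth_velocity hca hcτ hca hmaps
  have hW := isSmoothSpaceTimeOn_rescaled (e := fun t => exp (-(c * t))) hw hca hcτ hcd hmaps
  have hUs := isSmoothSpaceTimeOn_velocity (γ := fun _ : ℝ => c) contDiff_const hV hW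
  have hU1 : ContDiff ℝ 1 U := (hUs.contDiff_slice hsS).of_le (by norm_cast)
  -- the two vorticity slices, read on the coordinate plane
  set ωz : ℝ × ℝ → ℝ := fun p => curl U (embedXY (WithLp.toLp 2 ![p.1, p.2]) + z₀ • eZ) 2 with hωz
  set ωB : ℝ × ℝ → ℝ := fun p =>
    burgersVorticity c 1 Γ (embedXY (WithLp.toLp 2 ![p.1, p.2]) + z₀ • eZ) with hωB
  have hpt : Continuous fun p : ℝ × ℝ =>
      (embedXY (WithLp.toLp 2 ![p.1, p.2]) + z₀ • eZ : EuclideanSpace ℝ (Fin 3)) := by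
    have h1 : Continuous fun p : ℝ × ℝ => (WithLp.toLp 2 ![p.1, p.2] : EuclideanSpace ℝ (Fin 2)) := by
      refine (PiLp.continuous_toLp 2 _).comp ?_
      refine continuous_pi fun i => ?_
      fin_cases i
      · exact continuous_fst
      · exact continuous_snd
    exact (embedXY.continuous.comp h1).add continuous_const
  have hωzc : Continuous ωz :=
    (PiLp.continuous_apply 2 (fun _ : Fin 3 => ℝ) 2).comp ((continuous_curl hU1).comp hpt)
  have hωBc : Continuous ωB := (contDiff_burgersVorticity c 1 Γ (n := 0)).continuous.comp hpt
  -- Stokes for both fields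
  have hSU : circulation U (circleLoop (z₀ • eZ) r (EuclideanSpace.single 0 1) (EuclideanSpace.single 1 1)) =
      ∫ p in {p : ℝ × ℝ | p.1 ^ 2 + p.2 ^ 2 < r ^ 2}, ωz p := rimCirculation_eq_setIntegral_curl hU1 z₀ hr
  have hSB : Γ * (1 - exp (-(c * r ^ 2 / 4))) = ∫ p in {p : ℝ × ℝ | p.1 ^ 2 + p.2 ^ 2 < r ^ 2}, ωB p := by
    rw [← burgersVortex_rimCirculation c Γ z₀ r,
      rimCirculation_eq_setIntegral_curl (contDiff_burgersVortex c 1 Γ) z₀ hr]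
    refine setIntegral_congr_fun (measurableSet_disc r) fun p _ => ?_
    rw [curl_burgersVortex, PiLp.smul_apply, smul_eq_mul]
    simp [hωB]
  -- the whole-plane `L¹` defect, transported to the coordinate plane
  have hL1 := palasekTowerBreakdown_cosigned_childVorticity_L1_burgers_clock R k hl hS' hv hω hBS h0nn hΓ hw
    hmaps h0 hsS hs z₀
  set D₀ : ℝ := Real.sqrt (2 * Γ * ∫ η, PlanarEigenmode.vorticity (v 0) η *
    Real.log (PlanarEigenmode.vorticity (v 0) η /
      (Γ / (4 * π * c⁻¹) * exp (-(‖η‖ ^ 2 / (4 * c⁻¹)))))) * exp (-(c * s / 2)) with hD₀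
  have hF : Integrable (fun y : EuclideanSpace ℝ (Fin 2) =>
      |curl U (embedXY y + z₀ • eZ) 2 - burgersVorticity c 1 Γ (embedXY y + z₀ • eZ)|)
      (volume : Measure (EuclideanSpace ℝ (Fin 2))) := by
    refine (Integrable.sub ?_ (integrable_burgersVorticity_slice hcpos Γ z₀)).abs
    have e : (fun y : EuclideanSpace ℝ (Fin 2) => curl U (embedXY y + z₀ • eZ) 2) = fun y =>
        exp (c * s / 2) ^ 2 * PlanarEigenmode.vorticity (v ((exp (c * s) - 1) / c)) (exp (c * s / 2) • y) := by
      funext y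
      rw [hU, curl_lundgren_apply_two (γ := fun _ => c) (a := fun t => exp (c * t / 2))
        (τ := fun t => (exp (c * t) - 1) / c) (d := fun t => exp (-(c * t))) hv.smooth_velocity hw hmaps hsS,
        projXY_add_smul_eZ, projXY_embedXY]
    rw [e]
    exact ((integrable_planarVorticity hv hω (hmaps hsS)).comp_smul (exp_pos _).ne').const_mul _
  have hFt : Integrable (fun p : ℝ × ℝ => |ωz p - ωB p|) := by
    have := (Literature.Analysis.Calculus.integrable_comp_toLp_fin_two_iff (fun y : EuclideanSpace ℝ (Fin 2) =>
      |curl U (embedXY y + z₀ • eZ) 2 - burgersVorticity c 1 Γ (embedXY y + z₀ • eZ)|)).2 hF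
    simpa [hωz, hωB] using this
  have hdef : ∫ p : ℝ × ℝ, |ωz p - ωB p| ≤ D₀ := by
    have e := Literature.Analysis.Calculus.integral_euclidean_eq_integral_prod (fun y : EuclideanSpace ℝ (Fin 2) =>
      |curl U (embedXY y + z₀ • eZ) 2 - burgersVorticity c 1 Γ (embedXY y + z₀ • eZ)|)
    simp only at e
    rw [← e]
    exact hL1
  -- assemble
  have hIz : IntegrableOn ωz {p : ℝ × ℝ | p.1 ^ 2 + p.2 ^ 2 < r ^ 2} := integrableOn_disc hωzc hr
  have hIB : IntegrableOn ωB {p : ℝ × ℝ | p.1 ^ 2 + p.2 ^ 2 < r ^ 2} := integrableOn_disc hωBc hr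
  have hsplit : ∫ p in {p : ℝ × ℝ | p.1 ^ 2 + p.2 ^ 2 < r ^ 2}, ωz p =
      (∫ p in {p : ℝ × ℝ | p.1 ^ 2 + p.2 ^ 2 < r ^ 2}, ωB p) +
        ∫ p in {p : ℝ × ℝ | p.1 ^ 2 + p.2 ^ 2 < r ^ 2}, (ωz p - ωB p) := by
    rw [integral_sub hIz hIB]; ring
  have habs : |∫ p in {p : ℝ × ℝ | p.1 ^ 2 + p.2 ^ 2 < r ^ 2}, (ωz p - ωB p)| ≤ D₀ := by
    refine (abs_integral_le_integral_abs).trans ((setIntegral_le_integral hFt ?_).trans hdef)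
    exact Filter.Eventually.of_forall fun p => abs_nonneg _
  rw [hSU, hsplit, ← hSB]
  have := neg_abs_le (∫ p in {p : ℝ × ℝ | p.1 ^ 2 + p.2 ^ 2 < r ^ 2}, (ωz p - ωB p))
  linarith

/-- **THE CO-SIGNED CHILD MEETS THE CORE CLAUSE AFTER THE ENTROPY CLOCK** (same setting; a schedule `Sch`
of the rates, a height `|z₀| ≤ radius`): if at the strain time `s` of the window
`c₁N_{k+1}^{β−2}/4 ≤ Γ(1 − e^{−λA_k/(4N_{k+1}²)}) − (2ΓH₀)^{1/2}e^{−λA_k s/2}`, then the child's velocity field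
at time `s` carries a `CoreLedger`-admissible loop of level `k + 1` (the ledger circle in the plane `{x₂ = z₀}`
about the axis, wound four times) with circulation `≥ c₁N_{k+1}^{β−2}`.
[cite: GallayWayne2005, Lemma 3.2 and §3.4; Palasek2026ElementaryModel, §3.1] -/
theorem palasekTowerBreakdown_cosigned_child_coreClause (R : TowerRates) (Sch : Schedule R) (k : ℕ)
    {l : ℝ} (hl : 0 < l) (hS' : Convex ℝ S') (hv : IsClassicalNSSolutionOn S' 1 0 v q)
    (hω : HasUniformRapidDecayOn S' (fun σ η => PlanarEigenmode.vorticity (v σ) η))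
    (hBS : ∀ σ ∈ S', ∀ η, v σ η = biotSavart2D (PlanarEigenmode.vorticity (v σ)) η)
    (h0nn : ∀ η, 0 ≤ PlanarEigenmode.vorticity (v 0) η)
    (hΓ : 0 < ∫ y, PlanarEigenmode.vorticity (v 0) y)
    (hw : IsSmoothSpaceTimeOn S' w)
    (hmaps : MapsTo (fun t => (exp (l * R.A k * t) - 1) / (l * R.A k)) S S')
    (h0 : (0 : ℝ) ∈ S') {s : ℝ} (hsS : s ∈ S) (hs : 0 ≤ s) {z₀ : ℝ} (hz₀ : |z₀| ≤ Sch.radius)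
    (hclock : Sch.c₁ * R.N (k + 1) ^ (R.β - 2) / 4 ≤
      (∫ y, PlanarEigenmode.vorticity (v 0) y) * (1 - exp (-(l * R.A k / (4 * R.N (k + 1) ^ 2)))) -
        Real.sqrt (2 * (∫ y, PlanarEigenmode.vorticity (v 0) y) *
          ∫ η, PlanarEigenmode.vorticity (v 0) η *
            Real.log (PlanarEigenmode.vorticity (v 0) η /
              ((∫ y, PlanarEigenmode.vorticity (v 0) y) / (4 * π * (l * R.A k)⁻¹) *
                exp (-(‖η‖ ^ 2 / (4 * (l * R.A k)⁻¹)))))) * exp (-(l * R.A k * s / 2))) :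
    ∃ (x' : EuclideanSpace ℝ (Fin 3)) (γ : ℝ → EuclideanSpace ℝ (Fin 3)),
      ‖x'‖ ≤ Sch.radius ∧ ContDiff ℝ 1 γ ∧ γ 0 = γ 1 ∧
      (∀ σ ∈ Icc (0 : ℝ) 1, γ σ ∈ Metric.closedBall x' (1 / R.N (k + 1))) ∧
      (∀ σ ∈ Icc (0 : ℝ) 1, ‖deriv γ σ‖ ≤ 8 * π / R.N (k + 1)) ∧
      Sch.c₁ * R.N (k + 1) ^ (R.β - 2) ≤
        circulation (velocity (fun _ => l * R.A k)
          (fun t y => exp (l * R.A k * t / 2) •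
            v ((exp (l * R.A k * t) - 1) / (l * R.A k)) (exp (l * R.A k * t / 2) • y))
          (fun t y => exp (-(l * R.A k * t)) •
            w ((exp (l * R.A k * t) - 1) / (l * R.A k)) (exp (l * R.A k * t / 2) • y)) s) γ := by
  set c : ℝ := l * R.A k with hc
  have hcpos : 0 < c := mul_pos hl (R.A_pos k)
  have hN1 := R.N_pos (k + 1)
  -- smoothness of the slice (as in `_rimCirculation_ge`)
  have hca : ContDiff ℝ ∞ (fun t : ℝ => exp (c * t / 2)) := ((contDiff_const.mul contDiff_id).div_const 2).exp
  have hcτ : ContDiff ℝ ∞ (fun t : ℝ => (exp (c * t) - 1) / c) :=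
    (((contDiff_const.mul contDiff_id).exp).sub contDiff_const).div_const c
  have hcd : ContDiff ℝ ∞ (fun t : ℝ => exp (-(c * t))) := (contDiff_const.mul contDiff_id).neg.exp
  have hV := isSmoothSpaceTimeOn_rescaled (e := fun t => exp (c * t / 2)) hv.smooth_velocity hca hcτ hca hmaps
  have hW := isSmoothSpaceTimeOn_rescaled (e := fun t => exp (-(c * t))) hw hca hcτ hcd hmaps
  have hUs := isSmoothSpaceTimeOn_velocity (γ := fun _ : ℝ => c) contDiff_const hV hW
  have hU1 := (hUs.contDiff_slice hsS).of_le (show (1 : WithTop ℕ∞) ≤ ∞ by norm_cast)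
  have hzn : ‖(z₀ • eZ : EuclideanSpace ℝ (Fin 3))‖ ≤ Sch.radius := by
    rw [norm_smul, Real.norm_eq_abs]; simp [eZ]; exact hz₀
  refine coreClause_of_rimCirculation Sch (k + 1) hU1 (x := z₀ • eZ) hzn norm_eX norm_eY inner_eX_eY ?_
  have hge := palasekTowerBreakdown_cosigned_child_rimCirculation_ge R k hl hS' hv hω hBS h0nn hΓ hw hmaps h0
    hsS hs z₀ (r := 1 / R.N (k + 1)) (by positivity)
  have hx : l * R.A k * (1 / R.N (k + 1)) ^ 2 / 4 = l * R.A k / (4 * R.N (k + 1) ^ 2) := by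
    field_simp
  rw [hx] at hge
  exact hclock.trans hge


/-! ### §2 The core clock as a logarithm (any rates, any `λ` with `x_k ≥ 1.95`) -/

/-- **THE CORE CLOCK AS A LOGARITHM** (any rates `R`, any schedule, any level `k`, any `λ > 0` whose core ratio
`x_k = λN_k^{β−2b}` is at least `1.95`; the co-signed setting of `palasekTowerBreakdown_cosigned_child_coreClause`):
if the circulation is on the core-ledger scale with **`Γ ≥ 0.86·c₁·N_{k+1}^{β−2}`** and the strain clock has run
**`λA_k s ≥ log(3200·H₀/Γ)`** — stated as `3200·H₀ ≤ Γ·e^{λA_k s}` (no sign or size hypothesis on the hand-over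
entropy `H₀`) — then the child's flow at strain time `s` meets the level-`(k+1)` core clause on every
cross-section `{x₂ = z₀}`, `|z₀| ≤ radius` (`1 − e^{−x_k/4} ≥ 1 − (1 + x_k/4)⁻¹ ≥ 0.3277`;
`(2ΓH₀)^{1/2}e^{−λA_k s/2} ≤ Γ/40`; `4·0.86·(0.3277 − 1/40) > 1`). Replaces the level-dependent normalisation
`H₀ ≤ Γ` of `…_anyProfile_child_coreClause_wide`. MODEL statement; not about any registered flow.
[cite: GallayWayne2005, Lemma 3.2 and §3.4; Palasek2026ElementaryModel, §3.1] -/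
theorem palasekTowerBreakdown_cosigned_child_coreClause_logClock (R : TowerRates) (Sch : Schedule R) (k : ℕ)
    {l : ℝ} (hl : 0 < l) (hS' : Convex ℝ S') (hv : IsClassicalNSSolutionOn S' 1 0 v q)
    (hω : HasUniformRapidDecayOn S' (fun σ η => PlanarEigenmode.vorticity (v σ) η))
    (hBS : ∀ σ ∈ S', ∀ η, v σ η = biotSavart2D (PlanarEigenmode.vorticity (v σ)) η)
    (h0nn : ∀ η, 0 ≤ PlanarEigenmode.vorticity (v 0) η)
    (hΓ : 0 < ∫ y, PlanarEigenmode.vorticity (v 0) y)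
    (hw : IsSmoothSpaceTimeOn S' w)
    (hmaps : MapsTo (fun t => (exp (l * R.A k * t) - 1) / (l * R.A k)) S S')
    (h0 : (0 : ℝ) ∈ S') {s : ℝ} (hsS : s ∈ S) (hs : 0 ≤ s) {z₀ : ℝ} (hz₀ : |z₀| ≤ Sch.radius)
    (hx : 1.95 ≤ l * R.N k ^ (R.β - 2 * R.b))
    (hH : 3200 * (∫ η, PlanarEigenmode.vorticity (v 0) η *
        Real.log (PlanarEigenmode.vorticity (v 0) η /
          ((∫ y, PlanarEigenmode.vorticity (v 0) y) / (4 * π * (l * R.A k)⁻¹) *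
            exp (-(‖η‖ ^ 2 / (4 * (l * R.A k)⁻¹)))))) ≤
      (∫ y, PlanarEigenmode.vorticity (v 0) y) * exp (l * R.A k * s))
    (hC : 0.86 * Sch.c₁ * R.N (k + 1) ^ (R.β - 2) ≤ ∫ y, PlanarEigenmode.vorticity (v 0) y) :
    ∃ (x' : EuclideanSpace ℝ (Fin 3)) (γ : ℝ → EuclideanSpace ℝ (Fin 3)),
      ‖x'‖ ≤ Sch.radius ∧ ContDiff ℝ 1 γ ∧ γ 0 = γ 1 ∧
      (∀ σ ∈ Icc (0 : ℝ) 1, γ σ ∈ Metric.closedBall x' (1 / R.N (k + 1))) ∧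
      (∀ σ ∈ Icc (0 : ℝ) 1, ‖deriv γ σ‖ ≤ 8 * π / R.N (k + 1)) ∧
      Sch.c₁ * R.N (k + 1) ^ (R.β - 2) ≤
        circulation (velocity (fun _ => l * R.A k)
          (fun t y => exp (l * R.A k * t / 2) •
            v ((exp (l * R.A k * t) - 1) / (l * R.A k)) (exp (l * R.A k * t / 2) • y))
          (fun t y => exp (-(l * R.A k * t)) •
            w ((exp (l * R.A k * t) - 1) / (l * R.A k)) (exp (l * R.A k * t / 2) • y)) s) γ := by
  set c : ℝ := l * R.A k with hc
  have hcpos : 0 < c := mul_pos hl (R.A_pos k)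
  set Γ : ℝ := ∫ y, PlanarEigenmode.vorticity (v 0) y with hΓdef
  have hΓ0 : 0 ≤ Γ := hΓ.le
  set H₀ : ℝ := ∫ η, PlanarEigenmode.vorticity (v 0) η *
    Real.log (PlanarEigenmode.vorticity (v 0) η / (Γ / (4 * π * c⁻¹) * exp (-(‖η‖ ^ 2 / (4 * c⁻¹)))))
    with hH₀
  have hNβ : 0 < R.N (k + 1) ^ (R.β - 2) := Real.rpow_pos_of_pos (R.N_pos _) _
  refine palasekTowerBreakdown_cosigned_child_coreClause R Sch k hl hS' hv hω hBS h0nn hΓ hw hmaps h0 hsS hs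
    hz₀ ?_
  -- (i) `1 − e^{−x_k/4} ≥ 0.3277` from `x_k ≥ 1.95`
  set x : ℝ := l * R.N k ^ (R.β - 2 * R.b) with hxdef
  have hxq : c / (4 * R.N (k + 1) ^ 2) = x / 4 := by
    rw [hxdef, hc, ← palasekTowerBreakdown_coreRatio_eq]; ring
  have hx0 : 0 < 1 + x / 4 := by linarith
  have he : exp (-(x / 4)) ≤ (1 + x / 4)⁻¹ := by
    rw [Real.exp_neg, inv_le_inv₀ (exp_pos _) hx0]
    linarith [add_one_le_exp (x / 4)]
  have hinv : (1 + x / 4)⁻¹ ≤ 0.6723 := by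
    rw [inv_le_comm₀ hx0 (by norm_num)]
    norm_num; linarith
  have h1 : 0.3277 ≤ 1 - exp (-(c / (4 * R.N (k + 1) ^ 2))) := by
    rw [hxq]; linarith [he.trans hinv]
  -- (ii) the clock defect `(2ΓH₀)^{1/2} e^{−cs/2} ≤ Γ/40` from `3200 H₀ ≤ Γ e^{cs}`
  have hE : 0 ≤ exp (-(c * s / 2)) := (exp_pos _).le
  have hE2 : exp (-(c * s / 2)) ^ 2 * exp (c * s) = 1 := by
    rw [sq, ← Real.exp_add, ← Real.exp_add, show -(c * s / 2) + -(c * s / 2) + c * s = 0 by ring, Real.exp_zero]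
  have hkey : 2 * Γ * H₀ * exp (-(c * s / 2)) ^ 2 ≤ (Γ / 40) ^ 2 := by
    have hfac : 2 * Γ * H₀ * exp (-(c * s / 2)) ^ 2 = Γ * exp (-(c * s / 2)) ^ 2 / 1600 * (3200 * H₀) := by
      ring
    rw [hfac]
    calc Γ * exp (-(c * s / 2)) ^ 2 / 1600 * (3200 * H₀)
        ≤ Γ * exp (-(c * s / 2)) ^ 2 / 1600 * (Γ * exp (c * s)) :=
          mul_le_mul_of_nonneg_left hH (by positivity)
      _ = (Γ / 40) ^ 2 * (exp (-(c * s / 2)) ^ 2 * exp (c * s)) := by ring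
      _ = (Γ / 40) ^ 2 := by rw [hE2, mul_one]
  have hdef : Real.sqrt (2 * Γ * H₀) * exp (-(c * s / 2)) ≤ Γ / 40 := by
    calc Real.sqrt (2 * Γ * H₀) * exp (-(c * s / 2))
        = Real.sqrt (2 * Γ * H₀) * Real.sqrt (exp (-(c * s / 2)) ^ 2) := by rw [Real.sqrt_sq hE]
      _ = Real.sqrt (2 * Γ * H₀ * exp (-(c * s / 2)) ^ 2) := (Real.sqrt_mul' _ (sq_nonneg _)).symm
      _ ≤ Real.sqrt ((Γ / 40) ^ 2) := Real.sqrt_le_sqrt hkey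
      _ = Γ / 40 := Real.sqrt_sq (by positivity)
  -- (iii) assemble: `c₁N^{β−2}/4 ≤ Γ/3.44 ≤ Γ(0.3277 − 1/40)`
  have hc₁ := Sch.c₁_pos
  have hmain : Sch.c₁ * R.N (k + 1) ^ (R.β - 2) / 4 ≤ Γ * 0.3277 - Γ / 40 := by
    nlinarith [hC, hNβ]
  refine hmain.trans ?_
  nlinarith [mul_le_mul_of_nonneg_left h1 hΓ0, hdef]

/-! ### §3 The tuned instance: `x_k ≥ 256·λ` at every level -/

/-- **The core ratio of the tuned rates is at least `256` at every level**: `N_k^{β−2b} = 2^{8.1·(33/32)^k} ≥ 2⁸`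
(`β − 2b = 27/80`, `N_k = 2^{24·(33/32)^k}`; level `0`: `2^{8.1} ≈ 274.4`). [folklore] -/
theorem TowerRates.tuned_coreRatio_ge (k : ℕ) :
    (256 : ℝ) ≤ TowerRates.tuned.N k ^ (TowerRates.tuned.β - 2 * TowerRates.tuned.b) := by
  rw [TowerRates.tuned_N_eq_two_rpow, ← Real.rpow_mul (by norm_num : (0 : ℝ) ≤ 2)]
  have hb : (1 : ℝ) ≤ (33 / 32 : ℝ) ^ k := one_le_pow₀ (by norm_num)
  have hexp : (8 : ℝ) ≤ 24 * (33 / 32 : ℝ) ^ k * (TowerRates.tuned.β - 2 * TowerRates.tuned.b) := by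
    simp only [TowerRates.tuned]; nlinarith
  calc (256 : ℝ) = (2 : ℝ) ^ (8 : ℝ) := by
        rw [show (8 : ℝ) = ((8 : ℕ) : ℝ) by norm_num, Real.rpow_natCast]; norm_num
    _ ≤ (2 : ℝ) ^ (24 * (33 / 32 : ℝ) ^ k * (TowerRates.tuned.β - 2 * TowerRates.tuned.b)) :=
        Real.rpow_le_rpow_of_exponent_le (by norm_num) hexp

/-- **THE CORE CLOCK AT THE TUNED RATES** (`TowerRates.tuned = (2^24, 33/32, 12/5, 49/20)`, any schedule, any
level `k`, any `λ ≥ 1/100`; the co-signed setting): **`3200·H₀ ≤ Γ·e^{λA_k s}` and `Γ ≥ 0.86·c₁N_{k+1}^{β−2}`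
⇒ the child's flow at strain time `s` meets the level-`(k+1)` core clause** on every cross-section `{x₂ = z₀}`,
`|z₀| ≤ radius` (`x_k ≥ 256·λ ≥ 2.56`). MODEL statement; not about any registered flow.
[cite: GallayWayne2005, Lemma 3.2 and §3.4; Palasek2026ElementaryModel, §3 (3.2), §3.1] -/
theorem palasekTowerBreakdown_cosigned_child_coreClause_logClock_tuned (Sch : Schedule TowerRates.tuned) (k : ℕ)
    {l : ℝ} (hl : 1 / 100 ≤ l) (hS' : Convex ℝ S') (hv : IsClassicalNSSolutionOn S' 1 0 v q)
    (hω : HasUniformRapidDecayOn S' (fun σ η => PlanarEigenmode.vorticity (v σ) η))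
    (hBS : ∀ σ ∈ S', ∀ η, v σ η = biotSavart2D (PlanarEigenmode.vorticity (v σ)) η)
    (h0nn : ∀ η, 0 ≤ PlanarEigenmode.vorticity (v 0) η)
    (hΓ : 0 < ∫ y, PlanarEigenmode.vorticity (v 0) y)
    (hw : IsSmoothSpaceTimeOn S' w)
    (hmaps : MapsTo (fun t => (exp (l * TowerRates.tuned.A k * t) - 1) / (l * TowerRates.tuned.A k)) S S')
    (h0 : (0 : ℝ) ∈ S') {s : ℝ} (hsS : s ∈ S) (hs : 0 ≤ s) {z₀ : ℝ} (hz₀ : |z₀| ≤ Sch.radius)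
    (hH : 3200 * (∫ η, PlanarEigenmode.vorticity (v 0) η *
        Real.log (PlanarEigenmode.vorticity (v 0) η /
          ((∫ y, PlanarEigenmode.vorticity (v 0) y) / (4 * π * (l * TowerRates.tuned.A k)⁻¹) *
            exp (-(‖η‖ ^ 2 / (4 * (l * TowerRates.tuned.A k)⁻¹)))))) ≤
      (∫ y, PlanarEigenmode.vorticity (v 0) y) * exp (l * TowerRates.tuned.A k * s))
    (hC : 0.86 * Sch.c₁ * TowerRates.tuned.N (k + 1) ^ (TowerRates.tuned.β - 2) ≤
      ∫ y, PlanarEigenmode.vorticity (v 0) y) :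
    ∃ (x' : EuclideanSpace ℝ (Fin 3)) (γ : ℝ → EuclideanSpace ℝ (Fin 3)),
      ‖x'‖ ≤ Sch.radius ∧ ContDiff ℝ 1 γ ∧ γ 0 = γ 1 ∧
      (∀ σ ∈ Icc (0 : ℝ) 1, γ σ ∈ Metric.closedBall x' (1 / TowerRates.tuned.N (k + 1))) ∧
      (∀ σ ∈ Icc (0 : ℝ) 1, ‖deriv γ σ‖ ≤ 8 * π / TowerRates.tuned.N (k + 1)) ∧
      Sch.c₁ * TowerRates.tuned.N (k + 1) ^ (TowerRates.tuned.β - 2) ≤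
        circulation (velocity (fun _ => l * TowerRates.tuned.A k)
          (fun t y => exp (l * TowerRates.tuned.A k * t / 2) •
            v ((exp (l * TowerRates.tuned.A k * t) - 1) / (l * TowerRates.tuned.A k))
              (exp (l * TowerRates.tuned.A k * t / 2) • y))
          (fun t y => exp (-(l * TowerRates.tuned.A k * t)) •
            w ((exp (l * TowerRates.tuned.A k * t) - 1) / (l * TowerRates.tuned.A k))
              (exp (l * TowerRates.tuned.A k * t / 2) • y)) s) γ := by
  have hl0 : 0 < l := by linarith
  have hN := TowerRates.tuned_coreRatio_ge k
  have hx : 1.95 ≤ l * TowerRates.tuned.N k ^ (TowerRates.tuned.β - 2 * TowerRates.tuned.b) := by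
    nlinarith
  exact palasekTowerBreakdown_cosigned_child_coreClause_logClock TowerRates.tuned Sch k hl0 hS' hv hω hBS h0nn
    hΓ hw hmaps h0 hsS hs hz₀ hx hH hC

end Summit.NavierStokesRegularity.FluidComputer.PalasekTowerClayBridge
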